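import Literature.Analysis.PDE.WeakHarnack
import Literature.Analysis.PDE.EvansKrylovPowerMean
import HarnessLib

/-!
# Auxiliary facts for the Evans–Krylov oscillation decay (Gilbarg–Trudinger §17.4)

Bookkeeping for the derivation of GT's (17.49)–(17.51) from the small-ball weak Harnack
inequality `KrylovSafonov.weakHarnack`:

* the weak Harnack exponent satisfies `0 < p ≤ 1` when `Λ/λ ≥ 1` and the constant is positive
  (`pWH_pos`, `pWH_le_one`, `CWH_pos`), so that the power-mean inequalities of
  `EvansKrylovPowerMean` apply;
* the Hessian matrix of `c - w` is minus that of `w` (`hessianMatrix_const_sub`);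
* suprema and infima of the image of a ball under a `[0,1]`-valued function, and passing a
  continuous inequality to the supremum (`le_apply_csSup_of_forall`);
* splitting a `lintegral` of `ofReal (c * (A + Σ_k g_k))` over a ball.

## References

* D. Gilbarg, N. S. Trudinger, *Elliptic Partial Differential Equations of Second Order* (2001),
  §17.4, (17.49)–(17.51), and Theorem 9.22. [GilbargTrudinger2001]
-/

noncomputable section

open Set InnerProductSpace Matrix Filter Metric MeasureTheory WithLp
open scoped Topology ENNReal RealInnerProductSpace

namespace Literature.Analysis.PDE.EvansKrylov

open Literature.Analysis.PDE.ABP Literature.Analysis.PDE.KrylovSafonov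
  Literature.MeasureTheory.Covering.Dyadic

variable {ι : Type*} [Fintype ι] [DecidableEq ι]

/-! ### The weak Harnack exponent and constant -/

omit [DecidableEq ι] in
/-- `0 < α_n`, `α_n² < 1` and `0 < 1 - (3α_n√n)²`. [folklore] -/
theorem alphaWH_bounds [Nonempty ι] :
    0 < alphaWH ι ∧ alphaWH ι ^ 2 < 1 ∧
      0 < 1 - (3 * alphaWH ι * Real.sqrt (Fintype.card ι)) ^ 2 := by
  obtain ⟨hα0, hρ1⟩ := alphaWH_pos (ι := ι)
  have hn1 : (1 : ℝ) ≤ Fintype.card ι := by exact_mod_cast Fintype.card_pos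
  have hsqn : 1 ≤ Real.sqrt (Fintype.card ι) := by
    rw [← Real.sqrt_one]; exact Real.sqrt_le_sqrt hn1
  refine ⟨hα0, by nlinarith, ?_⟩
  have : 0 ≤ 3 * alphaWH ι * Real.sqrt (Fintype.card ι) := by positivity
  nlinarith

omit [DecidableEq ι] in
/-- The `δ` of the weak Harnack data lies in `[1/2, 1)`. [folklore] -/
theorem deltaWH_bounds [Nonempty ι] {ratio : ℝ} (hr : 0 ≤ ratio) :
    1 / 2 ≤ deltaWH ι 1 ratio (mWH ι ratio) (alphaWH ι) ∧
      deltaWH ι 1 ratio (mWH ι ratio) (alphaWH ι) < 1 := by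
  obtain ⟨hα0, hα1, -⟩ := alphaWH_bounds (ι := ι)
  obtain ⟨hθ0, hθ⟩ := thetaCube_pos (ι := ι) one_pos hr (mWH ι ratio) hα0 hα1
  unfold deltaWH
  constructor <;> linarith

omit [DecidableEq ι] in
/-- The `C` of the weak Harnack data is `≥ 1/2` (indeed huge) when `Λ/λ ≥ 1`. [folklore] -/
theorem half_le_growthC [Nonempty ι] {ratio : ℝ} (hr : 1 ≤ ratio) :
    1 / 2 ≤ growthC (Fintype.card ι) 1 ratio (mWH ι ratio) (alphaWH ι) := by
  obtain ⟨hα0, hα1, hρ⟩ := alphaWH_bounds (ι := ι)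
  set n := Fintype.card ι with hn
  set α := alphaWH ι
  set m := mWH ι ratio with hm
  have hn1 : (1 : ℝ) ≤ n := by exact_mod_cast Fintype.card_pos
  have hn0 : (0 : ℝ) < n := by linarith
  -- `m ≥ n`
  have hmn : (n : ℝ) ≤ m := by
    have hceil : (n : ℝ) * ratio / (2 * α ^ 2) ≤ m := by rw [hm, mWH]; exact Nat.le_ceil _
    have hsqn : 1 ≤ Real.sqrt n := by rw [← Real.sqrt_one]; exact Real.sqrt_le_sqrt hn1
    have h2α : 2 * α ^ 2 ≤ 1 := by
      obtain ⟨-, hρ1⟩ := alphaWH_pos (ι := ι)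
      have : α ≤ 3 * α * Real.sqrt n := by nlinarith
      nlinarith
    have h1 : (n : ℝ) * ratio ≤ n * ratio / (2 * α ^ 2) :=
      le_div_self (by positivity) (by positivity) h2α
    nlinarith
  -- the base of `supBound` is `≥ 1`
  have hbase : (1 : ℝ) ≤ (4 * ((m + 2 : ℕ) : ℝ) ^ 2 * ratio + 1) / (n * 1) := by
    rw [mul_one, one_le_div hn0]
    have hm0 : (0 : ℝ) ≤ m := by positivity
    push_cast
    nlinarith
  have hK : (1 : ℝ) ≤ coreK₁ n 1 ratio m := by
    unfold coreK₁
    exact one_le_mul_of_one_le_of_one_le (one_le_pow₀ one_le_two) (one_le_pow₀ hbase)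
  have hsup : (1 : ℝ) ≤ supBound n 1 ratio m := by
    unfold supBound
    exact Real.one_le_rpow (one_le_mul_of_one_le_of_one_le (one_le_pow₀ one_le_two) hK)
      (by positivity)
  have hden1 : (1 - (3 * α * Real.sqrt n) ^ 2) ^ (m + 2) ≤ 1 :=
    pow_le_one₀ hρ.le (by nlinarith [sq_nonneg (3 * α * Real.sqrt n)])
  have hC : supBound n 1 ratio m ≤ growthC n 1 ratio m α := by
    unfold growthC
    exact le_div_self (by linarith) (pow_pos hρ _) hden1
  linarith

omit [DecidableEq ι] in
/-- **The weak Harnack exponent is positive.** [cite: GilbargTrudinger2001, Thm 9.22] -/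
theorem pWH_pos [Nonempty ι] {ratio : ℝ} (hr : 0 ≤ ratio) : 0 < pWH ι ratio := by
  obtain ⟨-, -, hρ⟩ := alphaWH_bounds (ι := ι)
  obtain ⟨hδ, hδ1⟩ := deltaWH_bounds (ι := ι) hr
  unfold pWH expWH
  refine half_pos (kappa_pos (by linarith) hδ1 ?_)
  unfold growthC
  exact div_pos (supBound_pos Fintype.card_ne_zero one_pos hr _) (pow_pos hρ _)

omit [DecidableEq ι] in
/-- **The weak Harnack exponent is at most `1`** (for `Λ/λ ≥ 1`). [folklore] -/
theorem pWH_le_one [Nonempty ι] {ratio : ℝ} (hr : 1 ≤ ratio) : pWH ι ratio ≤ 1 := by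
  obtain ⟨hδ, hδ1⟩ := deltaWH_bounds (ι := ι) (zero_le_one.trans hr)
  have hC := half_le_growthC (ι := ι) hr
  set δ := deltaWH ι 1 ratio (mWH ι ratio) (alphaWH ι)
  set C := growthC (Fintype.card ι) 1 ratio (mWH ι ratio) (alphaWH ι)
  have hδ0 : 0 < δ := by linarith
  -- `-log δ ≤ δ⁻¹ - 1 ≤ 1`
  have hlog : -Real.log δ ≤ 1 := by
    have h1 := Real.one_sub_inv_le_log_of_pos hδ0
    have h2 : δ⁻¹ ≤ 2 := by rw [inv_le_comm₀ hδ0 two_pos]; linarith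
    linarith
  unfold pWH expWH kappa
  rw [div_div, div_le_one (by positivity)]
  linarith

omit [DecidableEq ι] in
/-- **The weak Harnack constant is positive.** [cite: GilbargTrudinger2001, Thm 9.22] -/
theorem CWH_pos [Nonempty ι] {ratio : ℝ} (hr : 0 ≤ ratio) : 0 < CWH ι ratio := by
  obtain ⟨hα0, -, -⟩ := alphaWH_bounds (ι := ι)
  obtain ⟨hδ, -⟩ := deltaWH_bounds (ι := ι) hr
  unfold CWH constWH
  have : 0 < deltaWH ι 1 ratio (mWH ι ratio) (alphaWH ι) := by linarith
  positivity

/-! ### The Hessian of `c - w` and the weak Harnack inequality for `W - w` -/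

section Hessian

variable {E : Type*} [NormedAddCommGroup E] [InnerProductSpace ℝ E]

omit [DecidableEq ι] in
/-- The Hessian matrix of `c - w` is minus that of `w`. [folklore] -/
theorem hessianMatrix_const_sub (b : OrthonormalBasis ι ℝ E) (c : ℝ) {w : E → ℝ} {x : E}
    (hw : ∀ᶠ y in 𝓝 x, DifferentiableAt ℝ w y)
    (hw2 : DifferentiableAt ℝ (fderiv ℝ w) x) :
    hessianMatrix (fun y ↦ c - w y) b x = -hessianMatrix w b x := by
  have e : (fun y ↦ c - w y) = fun y ↦ (-1) * w y + c := by funext y; ring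
  rw [e, hessianMatrix_add_const, hessianMatrix_const_mul b (-1) hw hw2, neg_one_smul]

omit [DecidableEq ι] in
/-- `a : D²(c - w) = -a : D²w` at points of an open set where `w` is `C²`. [folklore] -/
theorem pair_hessianMatrix_const_sub (b : OrthonormalBasis ι ℝ E) {U : Set E} (hU : IsOpen U)
    {w : E → ℝ} (hw : ContDiffOn ℝ 2 w U) {x : E} (hx : x ∈ U) (a : Matrix ι ι ℝ)
    (c : ℝ) :
    pair a (hessianMatrix (fun y ↦ c - w y) b x) = -pair a (hessianMatrix w b x) := by
  have hev : ∀ᶠ y in 𝓝 x, DifferentiableAt ℝ w y := by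
    filter_upwards [hU.mem_nhds hx] with y hy
    exact (hw.differentiableOn (by norm_num)).differentiableAt (hU.mem_nhds hy)
  have hw2 : DifferentiableAt ℝ (fderiv ℝ w) x :=
    ((hw.fderiv_of_isOpen hU (m := 1) (by norm_num)).differentiableOn one_ne_zero).differentiableAt
      (hU.mem_nhds hx)
  rw [hessianMatrix_const_sub b c hev hw2,
    show -hessianMatrix w b x = (-1 : ℝ) • hessianMatrix w b x by rw [neg_one_smul], pair_smul,
    neg_one_mul]

end Hessian

/-- **Weak Harnack for `W - w`**: if `w` is `C²`, measurable, `a : D²w ≥ -f₀` on `B_R(y₀)`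
and `w ≤ W` on `B̄_R(y₀)`, then `∫_{B_{αR}} (W - w + N)^p ≤ C Rⁿ (W - w(x) + N)^p` for
`x ∈ B_{αR}`, `N > 0`, `N ≥ R²f₀/λ`.
[cite: GilbargTrudinger2001, §17.4, (17.49) (from Thm 9.22)] -/
theorem weakHarnack_const_sub [Nonempty ι] {U : Set (EuclideanSpace ℝ ι)} (hU : IsOpen U)
    {y₀ : EuclideanSpace ℝ ι} {R : ℝ} (hR : 0 < R) (hBU : closedBall y₀ R ⊆ U)
    {w : EuclideanSpace ℝ ι → ℝ} (hw : ContDiffOn ℝ 2 w U) (hmeas : Measurable w) {W : ℝ}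
    (hW : ∀ y ∈ closedBall y₀ R, w y ≤ W) {f₀ : ℝ} (hf₀ : 0 ≤ f₀)
    {a : EuclideanSpace ℝ ι → Matrix ι ι ℝ} (ha : ∀ y ∈ ball y₀ R, (a y).IsSymm)
    {lam Λ : ℝ} (hlam0 : 0 < lam)
    (hlam : ∀ y ∈ ball y₀ R, ∀ ξ : ι → ℝ, lam * (ξ ⬝ᵥ ξ) ≤ ξ ⬝ᵥ (a y *ᵥ ξ))
    (hΛ : ∀ y ∈ ball y₀ R, ∀ ξ : ι → ℝ, ξ ⬝ᵥ (a y *ᵥ ξ) ≤ Λ * (ξ ⬝ᵥ ξ))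
    (hsuper : ∀ y ∈ ball y₀ R,
      -f₀ ≤ pair (a y) (hessianMatrix w (EuclideanSpace.basisFun ι ℝ) y))
    {N : ℝ} (hN0 : 0 < N) (hNf : R ^ 2 * f₀ / lam ≤ N)
    {x : EuclideanSpace ℝ ι} (hx : x ∈ ball y₀ (alphaWH ι * R)) :
    ∫⁻ y in ball y₀ (alphaWH ι * R), ENNReal.ofReal ((W - w y + N) ^ pWH ι (Λ / lam)) ≤
      ENNReal.ofReal
        (CWH ι (Λ / lam) * R ^ Fintype.card ι * (W - w x + N) ^ pWH ι (Λ / lam)) := by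
  have hu : ContDiffOn ℝ 2 (fun y ↦ W - w y) U := contDiffOn_const.sub hw
  have hum : Measurable fun y ↦ W - w y := measurable_const.sub hmeas
  have hu0 : ∀ y ∈ closedBall y₀ R, 0 ≤ W - w y := fun y hy ↦ sub_nonneg.2 (hW y hy)
  have hf : ∀ y ∈ ball y₀ R, |(fun _ ↦ f₀) y| ≤ f₀ := fun y _ ↦
    (abs_of_nonneg hf₀).le
  have hsuper' : ∀ y ∈ ball y₀ R,
      pair (a y) (hessianMatrix (fun y ↦ W - w y) (EuclideanSpace.basisFun ι ℝ) y) ≤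
        (fun _ ↦ f₀) y := fun y hy ↦ by
    rw [pair_hessianMatrix_const_sub _ hU hw (hBU (ball_subset_closedBall hy))]
    linarith [hsuper y hy]
  exact weakHarnack hU hR hBU hu hum hu0 hf ha hlam0 hlam hΛ hsuper' hN0 hNf hx

/-! ### Suprema and infima over balls -/

section SupInf

variable {E : Type*} [PseudoMetricSpace E]

/-- The image of a ball under a `[0,1]`-valued function is bounded above. [folklore] -/
theorem bddAbove_image_ball {h : E → ℝ} {y₀ : E} {r R : ℝ} (hr : r ≤ R)
    (h01 : ∀ y ∈ closedBall y₀ R, 0 ≤ h y ∧ h y ≤ 1) : BddAbove (h '' ball y₀ r) :=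
  ⟨1, by
    rintro _ ⟨y, hy, rfl⟩
    exact (h01 y (closedBall_subset_closedBall hr (ball_subset_closedBall hy))).2⟩

/-- The image of a ball under a `[0,1]`-valued function is bounded below. [folklore] -/
theorem bddBelow_image_ball {h : E → ℝ} {y₀ : E} {r R : ℝ} (hr : r ≤ R)
    (h01 : ∀ y ∈ closedBall y₀ R, 0 ≤ h y ∧ h y ≤ 1) : BddBelow (h '' ball y₀ r) :=
  ⟨0, by
    rintro _ ⟨y, hy, rfl⟩
    exact (h01 y (closedBall_subset_closedBall hr (ball_subset_closedBall hy))).1⟩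

/-- `inf_B h ≤ h y ≤ sup_B h` on the ball `B`. [folklore] -/
theorem csInf_le_le_csSup_image_ball {h : E → ℝ} {y₀ : E} {r R : ℝ} (hr : r ≤ R)
    (h01 : ∀ y ∈ closedBall y₀ R, 0 ≤ h y ∧ h y ≤ 1) {y : E} (hy : y ∈ ball y₀ r) :
    sInf (h '' ball y₀ r) ≤ h y ∧ h y ≤ sSup (h '' ball y₀ r) :=
  ⟨csInf_le (bddBelow_image_ball hr h01) (mem_image_of_mem h hy),
    le_csSup (bddAbove_image_ball hr h01) (mem_image_of_mem h hy)⟩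

/-- `0 ≤ inf_B h ≤ sup_B h ≤ 1` for a `[0,1]`-valued `h` and a nonempty ball `B`.
[folklore] -/
theorem csInf_csSup_image_ball_mem {h : E → ℝ} {y₀ : E} {r R : ℝ} (hr0 : 0 < r)
    (hr : r ≤ R) (h01 : ∀ y ∈ closedBall y₀ R, 0 ≤ h y ∧ h y ≤ 1) :
    0 ≤ sInf (h '' ball y₀ r) ∧ sInf (h '' ball y₀ r) ≤ sSup (h '' ball y₀ r) ∧
      sSup (h '' ball y₀ r) ≤ 1 := by
  have hne : (h '' ball y₀ r).Nonempty := ⟨h y₀, mem_image_of_mem h (mem_ball_self hr0)⟩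
  have hmem : ∀ t ∈ h '' ball y₀ r, 0 ≤ t ∧ t ≤ 1 := by
    rintro _ ⟨y, hy, rfl⟩
    exact h01 y (closedBall_subset_closedBall hr (ball_subset_closedBall hy))
  have h2 := csInf_le_le_csSup_image_ball hr h01 (mem_ball_self hr0) (h := h)
  exact ⟨le_csInf hne fun t ht ↦ (hmem t ht).1, h2.1.trans h2.2,
    csSup_le hne fun t ht ↦ (hmem t ht).2⟩

/-- Monotonicity of `sup_B h` and `inf_B h` in the (concentric) ball. [folklore] -/
theorem csSup_image_ball_mono {h : E → ℝ} {y₀ : E} {r R : ℝ} (hr0 : 0 < r) (hr : r ≤ R)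
    (h01 : ∀ y ∈ closedBall y₀ R, 0 ≤ h y ∧ h y ≤ 1) :
    sSup (h '' ball y₀ r) ≤ sSup (h '' ball y₀ R) ∧
      sInf (h '' ball y₀ R) ≤ sInf (h '' ball y₀ r) := by
  have hne : (h '' ball y₀ r).Nonempty := ⟨h y₀, mem_image_of_mem h (mem_ball_self hr0)⟩
  have hsub : h '' ball y₀ r ⊆ h '' ball y₀ R := image_mono (ball_subset_ball hr)
  exact ⟨csSup_le_csSup (bddAbove_image_ball le_rfl h01) hne hsub,
    csInf_le_csInf (bddBelow_image_ball le_rfl h01) hne hsub⟩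

end SupInf

/-- On the CLOSED ball a continuous `h` still lies between `inf_B h` and `sup_B h` of the open
ball (`B̄_R = closure B_R` in a normed space, `R ≠ 0`). [folklore] -/
theorem csInf_le_le_csSup_of_mem_closedBall {E : Type*} [NormedAddCommGroup E] [NormedSpace ℝ E]
    {h : E → ℝ} {y₀ : E} {R : ℝ} (hR : 0 < R)
    (h01 : ∀ y ∈ closedBall y₀ R, 0 ≤ h y ∧ h y ≤ 1)
    (hc : ContinuousOn h (closedBall y₀ R)) {y : E} (hy : y ∈ closedBall y₀ R) :
    sInf (h '' ball y₀ R) ≤ h y ∧ h y ≤ sSup (h '' ball y₀ R) := by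
  rw [← closure_ball y₀ hR.ne'] at hy hc
  have hin : ∀ z ∈ ball y₀ R,
      sInf (h '' ball y₀ R) ≤ h z ∧ h z ≤ sSup (h '' ball y₀ R) := fun z hz ↦
    csInf_le_le_csSup_image_ball le_rfl h01 hz
  exact ⟨le_on_closure (fun z hz ↦ (hin z hz).1) continuousOn_const hc hy,
    le_on_closure (fun z hz ↦ (hin z hz).2) hc continuousOn_const hy⟩

/-- **Passing an inequality to the supremum**: if `A ≤ F t` for all `t ∈ S` with `F`
continuous (into `ℝ≥0∞`) and `S ⊆ ℝ` nonempty and bounded above, then `A ≤ F (sup S)`.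
[folklore] -/
theorem le_apply_csSup_of_forall {S : Set ℝ} (hS : S.Nonempty) (hb : BddAbove S)
    {F : ℝ → ℝ≥0∞} (hF : Continuous F) {A : ℝ≥0∞} (h : ∀ t ∈ S, A ≤ F t) :
    A ≤ F (sSup S) :=
  (isClosed_le continuous_const hF).closure_subset_iff.2 h (csSup_mem_closure hS hb)

/-! ### Integrating a pointwise bound -/

/-- **Integrating a pointwise bound** `L ≤ c (A + Σ_k G_k)` on a set `s` of finite measure, with
`0 < p ≤ 1` (subadditivity of `t ↦ t^p`): `L^p |s| ≤ c^p (A^p |s| + Σ_k T_k)` whenever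
`∫_s G_k^p ≤ T_k`. [folklore] -/
theorem rpow_mul_measure_le_of_pointwise {E : Type*} [MeasurableSpace E] {μ : Measure E}
    {s : Set E} (hs : MeasurableSet s) (hμs : μ s ≠ ∞) {K : Type*} [Fintype K]
    {G : K → E → ℝ} (hGm : ∀ k, Measurable (G k)) (hG0 : ∀ k, ∀ y ∈ s, 0 ≤ G k y)
    {c A L p : ℝ} (hc : 0 ≤ c) (hA : 0 ≤ A) (hL : 0 ≤ L) (hp0 : 0 < p) (hp1 : p ≤ 1)
    (hle : ∀ y ∈ s, L ≤ c * (A + ∑ k, G k y)) {T : K → ℝ} (hT0 : ∀ k, 0 ≤ T k)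
    (hT : ∀ k, ∫⁻ y in s, ENNReal.ofReal (G k y ^ p) ∂μ ≤ ENNReal.ofReal (T k)) :
    L ^ p * (μ s).toReal ≤ c ^ p * (A ^ p * (μ s).toReal + ∑ k, T k) := by
  -- the pointwise bound, raised to the power `p`
  have hpt : ∀ y ∈ s, ENNReal.ofReal (L ^ p) ≤
      ENNReal.ofReal (c ^ p) * (ENNReal.ofReal (A ^ p) + ∑ k, ENNReal.ofReal (G k y ^ p)) := by
    intro y hy
    have hS : 0 ≤ ∑ k, G k y := Finset.sum_nonneg fun k _ ↦ hG0 k y hy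
    have h1 : L ^ p ≤ c ^ p * (A ^ p + ∑ k, G k y ^ p) := by
      calc L ^ p ≤ (c * (A + ∑ k, G k y)) ^ p := Real.rpow_le_rpow hL (hle y hy) hp0.le
        _ = c ^ p * (A + ∑ k, G k y) ^ p := Real.mul_rpow hc (by positivity)
        _ ≤ c ^ p * (A ^ p + ∑ k, G k y ^ p) := by
            refine mul_le_mul_of_nonneg_left ?_ (by positivity)
            exact (Real.rpow_add_le_add_rpow hA hS hp0.le hp1).trans (add_le_add le_rfl
              (rpow_sum_le_sum_rpow hp0 hp1 _ fun k _ ↦ hG0 k y hy))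
    calc ENNReal.ofReal (L ^ p) ≤ ENNReal.ofReal (c ^ p * (A ^ p + ∑ k, G k y ^ p)) :=
          ENNReal.ofReal_le_ofReal h1
      _ = _ := by
          have h0 : ∀ k, 0 ≤ G k y ^ p := fun k ↦ Real.rpow_nonneg (hG0 k y hy) p
          rw [ENNReal.ofReal_mul (by positivity), ENNReal.ofReal_add (by positivity)
            (Finset.sum_nonneg fun k _ ↦ h0 k), ENNReal.ofReal_sum_of_nonneg (fun k _ ↦ h0 k)]
  have hgm : ∀ k, Measurable fun y ↦ ENNReal.ofReal (G k y ^ p) := fun k ↦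
    ENNReal.measurable_ofReal.comp ((hGm k).pow_const p)
  -- integrate
  have hint : ENNReal.ofReal (L ^ p) * μ s ≤ ENNReal.ofReal (c ^ p) *
      (ENNReal.ofReal (A ^ p) * μ s + ∑ k, ENNReal.ofReal (T k)) := by
    calc ENNReal.ofReal (L ^ p) * μ s = ∫⁻ _ in s, ENNReal.ofReal (L ^ p) ∂μ :=
          (setLIntegral_const s _).symm
      _ ≤ ∫⁻ y in s, ENNReal.ofReal (c ^ p) *
            (ENNReal.ofReal (A ^ p) + ∑ k, ENNReal.ofReal (G k y ^ p)) ∂μ :=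
          setLIntegral_mono' hs hpt
      _ = ENNReal.ofReal (c ^ p) *
            (ENNReal.ofReal (A ^ p) * μ s +
              ∑ k, ∫⁻ y in s, ENNReal.ofReal (G k y ^ p) ∂μ) := by
          rw [lintegral_const_mul' _ _ ENNReal.ofReal_ne_top, lintegral_add_left measurable_const,
            setLIntegral_const, lintegral_finsetSum _ fun k _ ↦ hgm k]
      _ ≤ _ := by gcongr with k _; exact hT k
  -- back to real numbers
  have hm : μ s = ENNReal.ofReal (μ s).toReal := (ENNReal.ofReal_toReal hμs).symm
  rw [hm, ← ENNReal.ofReal_mul (by positivity), ← ENNReal.ofReal_mul (by positivity),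
    ← ENNReal.ofReal_sum_of_nonneg (fun k _ ↦ hT0 k), ← ENNReal.ofReal_add (by positivity)
    (Finset.sum_nonneg fun k _ ↦ hT0 k), ← ENNReal.ofReal_mul (by positivity),
    ENNReal.ofReal_le_ofReal_iff (mul_nonneg (by positivity) (add_nonneg (by positivity)
      (Finset.sum_nonneg fun k _ ↦ hT0 k)))] at hint
  exact hint

end Literature.Analysis.PDE.EvansKrylov
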